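import Literature.NumberTheory.ComplexMultiplication.EllipticUnits.UnitsInjectiveModSqrtNegSeven
import Literature.NumberTheory.ComplexMultiplication.EllipticUnits.KatoUnitRepRubinTheta
import Literature.NumberTheory.ComplexMultiplication.EllipticUnits.KroneckerLimitFormula
import Literature.NumberTheory.EllipticCurves.HeegnerPoints
import HarnessLib

set_option autoImplicit false

/-!
# Kato's unit representatives `_𝔞z_{7ⁿ𝔣}` at `K = ℚ(√−7)`, `𝔣 = 𝔭₇·(d)`, are GLOBAL units (from Kato 15.5 (1) on two prime divisors)

Topic `NumberTheory/ComplexMultiplication/EllipticUnits` (companion of `KroneckerLimitFormula.lean`'s named fact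
`kato155_isUnit_of_two_le_primeDivisors` and of `KatoEllipticUnitRepresentatives.lean`'s `sec155_exists_katoUnitRep`).  Cell `bsd-cm`,
seat `bsd-cm-prr-ty1` g35 (literature-prover), row K2C-15 of crux `stmt-BirchSwinnertonDyer-19945`, item [G4] of the CHECK line /
`g35/README-successor.md`.  PROVED modulo the displayed named fact `h155u` (an existing fact, not minted here); no definition, no new fact.

* (tree, reused) `Kato2004.kato155_isUnit_of_two_le_primeDivisors.of_isKatoUnitRep` — a Kato unit representative is a global
  unit when `pⁿ𝔣` has two distinct prime divisors (Kato 15.5 (1)); this file discharges its side conditions at `ℚ(√−7)`.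
* `not_isUnit_natCast_of_two_le`, `exists_two_primeDivisors_span_mul_span` — for `K ∋ s` quadratic with `s² = −7` and
  `2 ≤ d`, `7 ∤ d`: `(s)·(d)` has two distinct prime divisors (a prime above `7 ∋ s` and a prime above `d`; distinct by Bézout
  `7a + db = 1`).
* `not_isUnit_of_sq_eq_neg_seven`, `seven_mem_span_of_sq_eq_neg_seven`; ★ `mem_globalUnitsOf_of_isKatoUnitRep_sqrtNegSeven` —
  the combination at `K ∋ √−7`, `p = 7`, `𝔣 = (s)·(d)`, every level `n` (`UnitsInjectiveMod` from
  `UnitsSqrtNegSeven.unitsInjectiveMod_of_sq_eq_neg_seven`, `IsImaginaryQuadratic` from `s² = −7`).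

HONEST LABEL: bookkeeping around one existing named fact (`h155u`, Kato 15.5 (1) / de Shalit II.2.4 (iii)); stmt-19945 OPEN; no
summit statement is proved by this seat; BSD is claimed for no curve.

References: [Kato2004Asterisque] §15.5 (1) (p. 254: "_𝔞z_𝔣 is a unit if 𝔣 has at least two prime divisors"), §15.6 (p. 254);
[deShalit1987] II.2.4 Proposition (iii); [Cox2013] §5 Exercise 5.9.
-/

noncomputable section

open scoped NumberField
open NumberField IsDedekindDomain

namespace Literature.NumberTheory.ComplexMultiplication.EllipticUnits.KatoUnitRepGlobalUnit

open Literature.NumberTheory.EllipticCurves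
open Literature.NumberTheory.ComplexMultiplication.EllipticUnits.UnitsSqrtNegSeven

variable {K : Type} [Field K] [NumberField K]

/-- A number field containing a square root of `−7` is totally complex. [cite: Cox2013, §5.B (5.12) (imaginary quadratic fields)] -/
theorem isTotallyComplex_of_sq_eq_neg_seven' {s : K} (hs : s ^ 2 = -7) : IsTotallyComplex K := by
  refine ⟨fun v => ?_⟩
  rw [← InfinitePlace.not_isReal_iff_isComplex]
  intro hv
  have h : (InfinitePlace.embedding_of_isReal hv s) ^ 2 = -7 := by
    rw [← map_pow, hs, map_neg, map_ofNat]
  nlinarith [sq_nonneg (InfinitePlace.embedding_of_isReal hv s)]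

/-- `K ∋ √−7` quadratic is imaginary quadratic. [cite: Cox2013, §5.B (5.12)] -/
theorem isImaginaryQuadratic_of_sq_eq_neg_seven (h2 : Module.finrank ℚ K = 2) {s : K} (hs : s ^ 2 = -7) :
    IsImaginaryQuadratic K :=
  ⟨h2, isTotallyComplex_of_sq_eq_neg_seven' hs⟩

/-- **A natural number `d ≥ 2` is not a unit of `𝓞 K`** (its norm is `d^{[K:ℚ]} ≠ ±1`). [cite: Cox2013, §7.A (7.1) (the norm)] -/
theorem not_isUnit_natCast_of_two_le {d : ℕ} (hd : 2 ≤ d) : ¬ IsUnit ((d : ℕ) : 𝓞 K) := by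
  intro h
  have h1 := Int.isUnit_iff.mp (h.map (Algebra.norm ℤ))
  have hN : ((Algebra.norm ℤ ((d : ℕ) : 𝓞 K) : ℤ) : ℚ) = (d : ℚ) ^ Module.finrank ℚ K := by
    rw [Algebra.coe_norm_int]
    have : (((d : ℕ) : 𝓞 K) : K) = algebraMap ℚ K (d : ℚ) := by push_cast; rfl
    rw [this, Algebra.norm_algebraMap]
  have hpos : 0 < Module.finrank ℚ K := Module.finrank_pos
  have hge : (2 : ℚ) ^ Module.finrank ℚ K ≤ (d : ℚ) ^ Module.finrank ℚ K :=
    pow_le_pow_left₀ (by norm_num) (by exact_mod_cast hd) _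
  have h2le : (2 : ℚ) ≤ (2 : ℚ) ^ Module.finrank ℚ K := by
    calc (2 : ℚ) = 2 ^ 1 := by norm_num
      _ ≤ 2 ^ Module.finrank ℚ K := pow_le_pow_right₀ (by norm_num) hpos
  rcases h1 with h | h
  · have : ((Algebra.norm ℤ ((d : ℕ) : 𝓞 K) : ℤ) : ℚ) = 1 := by rw [h]; norm_num
    linarith
  · have : ((Algebra.norm ℤ ((d : ℕ) : 𝓞 K) : ℤ) : ℚ) = -1 := by rw [h]; norm_num
    have hnn : (0 : ℚ) ≤ (d : ℚ) ^ Module.finrank ℚ K := by positivity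
    linarith

/-- **`(s)·(d)` has two distinct prime divisors** for `s² = −7`, `2 ≤ d`, `7 ∤ d`: a prime `𝔮₁ ∋ 7` (then `𝔮₁ ∋ s` as `s² = −7`)
and a prime `𝔮₂ ∋ d`; they differ because `7a + db = 1`. [cite: Kato2004Asterisque, §15.5 (1) (p. 254: "at least two prime divisors")] -/
theorem exists_two_primeDivisors_span_mul_span (s : 𝓞 K) (hs : (s : K) ^ 2 = -7) {d : ℕ} (hd : 2 ≤ d)
    (h7 : ¬ 7 ∣ d) :
    ∃ 𝔮₁ 𝔮₂ : HeightOneSpectrum (𝓞 K), 𝔮₁ ≠ 𝔮₂ ∧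
      𝔮₁.asIdeal ∣ Ideal.span {s} * Ideal.span {((d : ℕ) : 𝓞 K)} ∧
      𝔮₂.asIdeal ∣ Ideal.span {s} * Ideal.span {((d : ℕ) : 𝓞 K)} := by
  have hs' : s ^ 2 = -7 := RingOfIntegers.eq_iff.mp (by push_cast; exact hs)
  -- a maximal ideal above `7`
  have h7u : ¬ IsUnit ((7 : ℕ) : 𝓞 K) := not_isUnit_natCast_of_two_le (by norm_num)
  obtain ⟨𝔭, h𝔭max, h7𝔭⟩ := Ideal.exists_le_maximal (Ideal.span {((7 : ℕ) : 𝓞 K)})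
    (fun h => h7u (Ideal.span_singleton_eq_top.mp h))
  have h7mem : (7 : 𝓞 K) ∈ 𝔭 := by
    have := h7𝔭 (Ideal.mem_span_singleton_self _)
    simpa using this
  have hsmem : s ∈ 𝔭 := by
    have hs2 : s * s ∈ 𝔭 := by
      rw [← sq, hs']
      exact 𝔭.neg_mem h7mem
    exact (h𝔭max.isPrime.mem_or_mem hs2).elim id id
  have h𝔭0 : 𝔭 ≠ ⊥ := fun h => by
    rw [h, Ideal.mem_bot] at h7mem
    exact (by norm_num : (7 : 𝓞 K) ≠ 0) h7mem
  -- a maximal ideal above `d`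
  have hdu : ¬ IsUnit ((d : ℕ) : 𝓞 K) := not_isUnit_natCast_of_two_le hd
  obtain ⟨𝔮, h𝔮max, hd𝔮⟩ := Ideal.exists_le_maximal (Ideal.span {((d : ℕ) : 𝓞 K)})
    (fun h => hdu (Ideal.span_singleton_eq_top.mp h))
  have hdmem : ((d : ℕ) : 𝓞 K) ∈ 𝔮 := hd𝔮 (Ideal.mem_span_singleton_self _)
  have h𝔮0 : 𝔮 ≠ ⊥ := fun h => by
    rw [h, Ideal.mem_bot] at hdmem
    exact (by exact_mod_cast (by omega : d ≠ 0) : ((d : ℕ) : 𝓞 K) ≠ 0) hdmem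
  refine ⟨⟨𝔭, h𝔭max.isPrime, h𝔭0⟩, ⟨𝔮, h𝔮max.isPrime, h𝔮0⟩, ?_, ?_, ?_⟩
  · -- distinct: `gcd(7, d) = 1`
    intro heq
    have heq' : 𝔭 = 𝔮 := congrArg HeightOneSpectrum.asIdeal heq
    have hcop : IsCoprime ((7 : ℕ) : 𝓞 K) ((d : ℕ) : 𝓞 K) := by
      have h1 : IsCoprime ((7 : ℕ) : ℤ) ((d : ℕ) : ℤ) :=
        Nat.isCoprime_iff_coprime.mpr ((Nat.Prime.coprime_iff_not_dvd (by norm_num)).mpr h7)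
      simpa using h1.map (Int.castRingHom (𝓞 K))
    obtain ⟨a, b, hab⟩ := hcop
    apply h𝔭max.ne_top
    rw [Ideal.eq_top_iff_one, ← hab]
    refine 𝔭.add_mem (𝔭.mul_mem_left a ?_) (𝔭.mul_mem_left b (heq' ▸ hdmem))
    simpa using h7mem
  · exact Dvd.dvd.mul_right ((Ideal.dvd_span_singleton).mpr hsmem) _
  · exact Dvd.dvd.mul_left ((Ideal.dvd_span_singleton).mpr hdmem) _

/-- `s` with `s² = −7` is not a unit of `𝓞 K` (else `7 = −s²` would be). [cite: Cox2013, §7.A (7.1) (the norm)] -/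
theorem not_isUnit_of_sq_eq_neg_seven (s : 𝓞 K) (hs : (s : K) ^ 2 = -7) : ¬ IsUnit s := by
  intro h
  have hs' : s ^ 2 = -7 := RingOfIntegers.eq_iff.mp (by push_cast; exact hs)
  have h7 : IsUnit ((7 : ℕ) : 𝓞 K) := by
    have h1 : IsUnit (s ^ 2) := h.pow 2
    rw [hs', IsUnit.neg_iff] at h1
    simpa using h1
  exact not_isUnit_natCast_of_two_le (by norm_num) h7

omit [NumberField K] in
/-- `7 ∈ (s)` for `s² = −7` (`7 = s·(−s)`). [cite: Kato2004Asterisque, §15.5 (p. 253)] -/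
theorem seven_mem_span_of_sq_eq_neg_seven (s : 𝓞 K) (hs : (s : K) ^ 2 = -7) : (7 : 𝓞 K) ∈ Ideal.span {s} := by
  have hs' : s ^ 2 = -7 := RingOfIntegers.eq_iff.mp (by push_cast; exact hs)
  have h : (7 : 𝓞 K) = s * (-s) := by linear_combination hs'
  rw [h]
  exact Ideal.mul_mem_right _ _ (Ideal.mem_span_singleton_self s)

/-- ★ **Kato's unit representatives at `K ∋ √−7`, `𝔣 = (s)·(d)` (`2 ≤ d`, `7 ∤ d`), are GLOBAL UNITS of `K(7ⁿ𝔣)` at every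
level `n`** — the tree's `kato155_isUnit_of_two_le_primeDivisors.of_isKatoUnitRep` with all its side conditions discharged:
`IsImaginaryQuadratic` from `s² = −7`, `katoModulus ≠ ⊥`, `UnitsInjectiveMod (7ⁿ𝔣)` (`UnitsSqrtNegSeven`), two prime divisors
(`exists_two_primeDivisors_span_mul_span`), and Kato's coprimality of the twist. Item [G4] of the K2C-15 CHECK line.
[cite: Kato2004Asterisque, §15.5 (1) (p. 254)] [cite: deShalit1987, II.2.4 Proposition (iii)] -/
theorem mem_globalUnitsOf_of_isKatoUnitRep_sqrtNegSeven [Fact (Nat.Prime 7)]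
    (h155u : Kato2004.kato155_isUnit_of_two_le_primeDivisors) (h2 : Module.finrank ℚ K = 2) (s : 𝓞 K) (hs : (s : K) ^ 2 = -7) (ι : K →+* ℂ) {d : ℕ} (hd : 2 ≤ d) (h7 : ¬ 7 ∣ d)
    {𝔣 : Ideal (𝓞 K)} (h𝔣 : 𝔣 = Ideal.span {s} * Ideal.span {((d : ℕ) : 𝓞 K)}) (n : ℕ) {𝔞 : Ideal (𝓞 K)}
    (h𝔞 : IsTwist 7 𝔣 𝔞) {u : (AlgebraicClosure K)ˣ} (hu : IsKatoUnitRep 7 ι 𝔣 n 𝔞 u) :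
    u ∈ globalUnitsOf (katoLayer 7 𝔣 n) := by
  have hs0 : s ≠ 0 := fun h => by
    rw [h] at hs; norm_num at hs
  have hd0 : ((d : ℕ) : 𝓞 K) ≠ 0 := by exact_mod_cast (by omega : d ≠ 0)
  have h𝔣0 : 𝔣 ≠ ⊥ := by
    rw [h𝔣]
    exact mul_ne_zero (Ideal.span_singleton_eq_bot.not.mpr hs0) (Ideal.span_singleton_eq_bot.not.mpr hd0)
  have h𝔪 : katoModulus 7 𝔣 n ≠ ⊥ := katoModulus_ne_bot 7 𝔣 h𝔣0 n
  -- `UnitsInjectiveMod (7ⁿ𝔣)`: `7ⁿ𝔣 ≤ (s) ∌ 1`, `7 ∈ (s)`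
  have hle : katoModulus 7 𝔣 n ≤ Ideal.span {s} := by
    rw [katoModulus, h𝔣]
    exact Ideal.mul_le_left.trans Ideal.mul_le_right
  have htop : Ideal.span {s} ≠ ⊤ := fun h => not_isUnit_of_sq_eq_neg_seven s hs (Ideal.span_singleton_eq_top.mp h)
  have hinj : UnitsInjectiveMod (katoModulus 7 𝔣 n) :=
    unitsInjectiveMod_of_sq_eq_neg_seven h2 hs htop (seven_mem_span_of_sq_eq_neg_seven s hs) hle
  -- two prime divisors of `7ⁿ𝔣`
  have htwo : ∃ 𝔮₁ 𝔮₂ : HeightOneSpectrum (𝓞 K), 𝔮₁ ≠ 𝔮₂ ∧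
      𝔮₁.asIdeal ∣ katoModulus 7 𝔣 n ∧ 𝔮₂.asIdeal ∣ katoModulus 7 𝔣 n := by
    obtain ⟨𝔮₁, 𝔮₂, hne, h1, h1'⟩ := exists_two_primeDivisors_span_mul_span s hs hd h7
    rw [← h𝔣] at h1 h1'
    exact ⟨𝔮₁, 𝔮₂, hne, h1.trans (Dvd.intro_left _ rfl), h1'.trans (Dvd.intro_left _ rfl)⟩
  exact Kato2004.kato155_isUnit_of_two_le_primeDivisors.of_isKatoUnitRep h155u
    (isImaginaryQuadratic_of_sq_eq_neg_seven h2 hs) ι h𝔪 hinj htwo (h𝔞.isCoprime_six_mul_katoModulus 7 𝔣 n) hu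

end Literature.NumberTheory.ComplexMultiplication.EllipticUnits.KatoUnitRepGlobalUnit

end
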